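import Summits.ValiantsHypothesis.ValiantsHypothesis.Theorems.BarrierLeverChowBenchmarkPairsDirichletPeel

/-!
# Route BarrierLever — item 22038 `ChowBenchmarkPairs`, line `moore-peel`: the DIRICHLET WINDOW MINORS
# `d(i,c)(x)` over any commutative ring, and the first two rules of their binary recursion (THEOREM W)

Helper file (`--supports stmt-ValiantsHypothesis-22038`; cell valiant-natproofs, rung V4, 𝒟-side benchmark of
record, line `moore_peel`, card v12d structural target #1 «the product formula for `det G^{(X)}_i`»; seat val-np-p4
gen 27, memo `HOME/val-np-p4/g27/MEMO-valnp4-g27.md`).  Closes NO item.  Two auxiliary definitions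
(`rising n x`, the rising factorial as a ring element, and `dirichletWindow x i c`, the general window minor matrix).

THE OBJECT.  For a commutative ring `R`, `x : R` and `i, c : ℕ`,
`dirichletWindow x i c ∈ Mat_i(R)` has entries `[T_j ⊆ T_{c+m}] · x^{(|T_{c+m}| - |T_j|)}` (`j, m < i`; `T_n = bits n`;
`x^{(n)} = x(x+1)⋯(x+n-1) = rising n x`): rows = the first `i` codes, columns = the window of `i` consecutive codes
from `c`.  The line's stage objects are its instances: `dirichletPeelPoly i = dirichletWindow X i (windowStart i)`
(`dirichletPeelPoly_eq_dirichletWindow`), `peelMatrix i = dirichletWindow 1 i (windowStart i)` over `ℤ`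
(`dirichletWindow_one_windowStart`).

THEOREM W (memo §0–§1; this file proves (R1) and (R2), the companion files (R3) and the corollaries).  With
`P = 2^K ≤ c + i - 1 < 2P`:
* (R1) `P ≤ c`: `det d(i, 2^K + r)(x) = x^i · det d(i, r)(x+1)` (`r + i ≤ 2^K`) — `det_dirichletWindow_shift`
  (the column code `2^K + r + m` carries the extra top bit, `x^{(n+1)} = x·(x+1)^{(n)}`; `Matrix.det_smul`).
* (R2) `c < P`, `i ≤ P`: `det d(s+n, a+s)(x) = ± x^s · det d(n, a)(x)` whenever `a + s + n = 2^K` —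
  `det_dirichletWindow_flip` (the `s` columns with code `≥ 2^K` are supported on the rows `j < s`, upper
  unitriangular times `x`; the remaining block «rows `[s, s+n)` × codes `[a+s, 2^K)`» is carried by COMPLEMENTATION
  `T ↦ [K] ∖ T` (`bits_two_pow_sub_one_sub`, `dirichlet_compl`) onto «rows `[0,n)` × window from `a`»).

WHAT THIS IS NOT: no statement at `x = 1` beyond rewriting; nothing on the segment-mean stub, on crux
stmt-ValiantsHypothesis-14610 or on `VP` versus `VNP`.
-/

set_option linter.dupNamespace false

namespace Summit.ValiantsHypothesis.ValiantsHypothesis.Theorems.BarrierLever.MoorePeel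

open Polynomial Finset Matrix

/-! ## 1. Rising factorials as ring elements -/

section Rising

variable {R : Type*} [CommRing R]

/-- The rising factorial `x^{(n)} = x(x+1)⋯(x+n-1)` of a ring element (`= (ascPochhammer R n).eval x`,
`rising_eq_eval_ascPochhammer`), defined by `x^{(0)} = 1`, `x^{(n+1)} = x · (x+1)^{(n)}`. -/
def rising : ℕ → R → R
  | 0, _ => 1
  | n + 1, x => x * rising n (x + 1)

/-- `x^{(0)} = 1`. -/
@[simp] theorem rising_zero (x : R) : rising 0 x = 1 := rfl

/-- `x^{(n+1)} = x · (x+1)^{(n)}`. -/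
theorem rising_succ (n : ℕ) (x : R) : rising (n + 1) x = x * rising n (x + 1) := rfl

/-- `x^{(1)} = x`. -/
@[simp] theorem rising_one (x : R) : rising 1 x = x := by
  rw [rising_succ, rising_zero, mul_one]

/-- `x^{(n)} = (ascPochhammer R n)(x)`. -/
theorem rising_eq_eval_ascPochhammer (n : ℕ) (x : R) : rising n x = (ascPochhammer R n).eval x := by
  induction n generalizing x with
  | zero => simp
  | succ n ih =>
    rw [rising_succ, ascPochhammer_succ_left, eval_mul, eval_X, eval_comp, eval_add, eval_X, eval_one, ih]

/-- Ring homomorphisms commute with rising factorials. -/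
theorem map_rising {S : Type*} [CommRing S] (f : R →+* S) (n : ℕ) (x : R) :
    f (rising n x) = rising n (f x) := by
  induction n generalizing x with
  | zero => simp
  | succ n ih => rw [rising_succ, rising_succ, map_mul, ih, map_add, map_one]

/-- `1^{(n)} = n!`. -/
theorem rising_one_left (n : ℕ) : rising n (1 : R) = (n.factorial : R) := by
  rw [rising_eq_eval_ascPochhammer, ascPochhammer_eval_one]

/-- At a natural number: `α^{(n)} = Nat.ascFactorial α n`. -/
theorem rising_natCast (α n : ℕ) : rising n (α : R) = (Nat.ascFactorial α n : R) := by
  rw [rising_eq_eval_ascPochhammer, ascPochhammer_nat_eq_natCast_ascFactorial]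

/-- In `ℤ[X]`: `X^{(n)} = ascPochhammer ℤ n`. -/
theorem rising_X_int (n : ℕ) : rising n (X : ℤ[X]) = ascPochhammer ℤ n := by
  rw [rising_eq_eval_ascPochhammer, ← ascPochhammer_map (Int.castRingHom ℤ[X]), eval_map]
  have : Int.castRingHom ℤ[X] = C := by ext; simp
  rw [this, eval₂_C_X]

end Rising

/-! ## 2. The Dirichlet window matrix -/

section Window

variable {R : Type*} [CommRing R]

/-- **The Dirichlet window matrix** `d(i,c)(x)[j,m] = [bits j ⊆ bits (c+m)] · x^{(|bits (c+m)| - |bits j|)}`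
(`j, m < i`): rows = the first `i` binary codes, columns = the `i` consecutive codes from `c`, weights = rising
factorials of the parameter `x`. -/
def dirichletWindow (x : R) (i c : ℕ) : Matrix (Fin i) (Fin i) R :=
  Matrix.of fun j m => if bits (j : ℕ) ⊆ bits (c + (m : ℕ))
    then rising ((bits (c + (m : ℕ))).card - (bits (j : ℕ)).card) x else 0

/-- Entries of the Dirichlet window matrix. -/
theorem dirichletWindow_apply (x : R) (i c : ℕ) (j m : Fin i) :
    dirichletWindow x i c j m = if bits (j : ℕ) ⊆ bits (c + (m : ℕ))
      then rising ((bits (c + (m : ℕ))).card - (bits (j : ℕ)).card) x else 0 := rfl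

/-- Ring homomorphisms act on the parameter. -/
theorem dirichletWindow_map {S : Type*} [CommRing S] (f : R →+* S) (x : R) (i c : ℕ) :
    (dirichletWindow x i c).map f = dirichletWindow (f x) i c := by
  ext j m
  rw [Matrix.map_apply, dirichletWindow_apply, dirichletWindow_apply]
  split_ifs
  · exact map_rising f _ _
  · exact map_zero f

/-- Hence `f (det d(i,c)(x)) = det d(i,c)(f x)`. -/
theorem map_det_dirichletWindow {S : Type*} [CommRing S] (f : R →+* S) (x : R) (i c : ℕ) :
    f (dirichletWindow x i c).det = (dirichletWindow (f x) i c).det := by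
  rw [RingHom.map_det, RingHom.mapMatrix_apply, dirichletWindow_map]

/-- The tree's generic Dirichlet stage matrix is the window at `c_i` with parameter `X`. -/
theorem dirichletPeelPoly_eq_dirichletWindow (i : ℕ) :
    dirichletPeelPoly i = dirichletWindow (X : ℤ[X]) i (windowStart i) := by
  ext j m
  rw [dirichletPeelPoly_apply, dirichletWindow_apply]
  split_ifs
  · rw [rising_X_int]
  · rfl

/-- At `x = 1` over `ℤ` the window at `c_i` is the factorial stage matrix `G_i` of the segment-mean peel. -/
theorem dirichletWindow_one_windowStart (i : ℕ) :
    dirichletWindow (1 : ℤ) i (windowStart i) = peelMatrix i := by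
  ext j m
  rw [dirichletWindow_apply, peelMatrix_apply]
  split_ifs
  · rw [rising_one_left]
  · rfl

/-- At a natural parameter `α` over `ℤ` the window at `c_i` is the kernel stage matrix with weights
`Nat.ascFactorial α`. -/
theorem dirichletWindow_natCast_windowStart (α i : ℕ) :
    dirichletWindow (α : ℤ) i (windowStart i) = kpeelMatrix (Nat.ascFactorial α) i := by
  ext j m
  rw [dirichletWindow_apply, kpeelMatrix_eq_kincl, kincl]
  split_ifs
  · rw [rising_natCast]
  · simp

/-- Rows of code `0` are trivial: `d(0,c) = ()` has determinant `1`. -/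
theorem det_dirichletWindow_zero_left (x : R) (c : ℕ) : (dirichletWindow x 0 c).det = 1 :=
  Matrix.det_fin_zero

/-! ## 3. Codes: monotonicity, the top bit, complements -/

/-- `bits a ⊆ bits b → a ≤ b` (codes are monotone). -/
theorem le_of_bits_subset {a b : ℕ} (h : bits a ⊆ bits b) : a ≤ b := by
  rw [← bin_bits a, ← bin_bits b, bin, bin]
  exact Finset.sum_le_sum_of_subset h

/-- `bits a ⊆ range k` for `a < 2^k`. -/
theorem bits_subset_range {a k : ℕ} (ha : a < 2 ^ k) : bits a ⊆ Finset.range k :=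
  fun _ ht => Finset.mem_range.mpr (lt_of_mem_bits ha ht)

/-- `k ∉ bits a` for `a < 2^k`. -/
theorem not_mem_bits_self {a k : ℕ} (ha : a < 2 ^ k) : k ∉ bits a :=
  fun h => lt_irrefl k (lt_of_mem_bits ha h)

/-- The complement code: `bits (2^k - 1 - a) = range k \ bits a` for `a < 2^k`. -/
theorem bits_two_pow_sub_one_sub {a k : ℕ} (ha : a < 2 ^ k) :
    bits (2 ^ k - 1 - a) = Finset.range k \ bits a := by
  ext t
  rw [Finset.mem_sdiff, Finset.mem_range, mem_bits, mem_bits,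
    show 2 ^ k - 1 - a = 2 ^ k - (a + 1) by omega, Nat.testBit_two_pow_sub_succ ha]
  simp

/-- Card of the complement code. -/
theorem card_bits_two_pow_sub_one_sub {a k : ℕ} (ha : a < 2 ^ k) :
    (bits (2 ^ k - 1 - a)).card = k - (bits a).card := by
  rw [bits_two_pow_sub_one_sub ha, Finset.card_sdiff_of_subset (bits_subset_range ha), Finset.card_range]

/-- Complementation reverses containment: for `a, b < 2^k`,
`bits (2^k-1-b) ⊆ bits (2^k-1-a) ↔ bits a ⊆ bits b`. -/
theorem bits_compl_subset_iff {a b k : ℕ} (ha : a < 2 ^ k) (hb : b < 2 ^ k) :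
    bits (2 ^ k - 1 - b) ⊆ bits (2 ^ k - 1 - a) ↔ bits a ⊆ bits b := by
  rw [bits_two_pow_sub_one_sub ha, bits_two_pow_sub_one_sub hb]
  constructor
  · intro h t ht
    by_contra htb
    have : t ∈ Finset.range k \ bits b :=
      Finset.mem_sdiff.mpr ⟨Finset.mem_range.mpr (lt_of_mem_bits ha ht), htb⟩
    exact (Finset.mem_sdiff.mp (h this)).2 ht
  · intro h
    exact Finset.sdiff_subset_sdiff (le_refl _) h

/-- **Complementation symmetry of the Dirichlet zeta entries**: for `a, b < 2^k` the entry at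
`(bits a, bits b)` equals the entry at `(bits (2^k-1-b), bits (2^k-1-a))`. -/
theorem dirichlet_compl (x : R) {a b k : ℕ} (ha : a < 2 ^ k) (hb : b < 2 ^ k) :
    (if bits (2 ^ k - 1 - b) ⊆ bits (2 ^ k - 1 - a)
      then rising ((bits (2 ^ k - 1 - a)).card - (bits (2 ^ k - 1 - b)).card) x else 0) =
    (if bits a ⊆ bits b then rising ((bits b).card - (bits a).card) x else 0) := by
  by_cases h : bits a ⊆ bits b
  · rw [if_pos ((bits_compl_subset_iff ha hb).mpr h), if_pos h,
      card_bits_two_pow_sub_one_sub ha, card_bits_two_pow_sub_one_sub hb]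
    have h1 : (bits a).card ≤ (bits b).card := Finset.card_le_card h
    have h2 : (bits b).card ≤ k := by
      simpa using Finset.card_le_card (bits_subset_range hb)
    congr 1
    omega
  · rw [if_neg (fun h' => h ((bits_compl_subset_iff ha hb).mp h')), if_neg h]

/-! ## 4. (R1): the top bit of the window start shifts the parameter -/

/-- Entrywise form of (R1): for `r + m < 2^k` and `j < 2^k`,
`d[j, 2^k + r + m](x) = x · d[j, r + m](x+1)`. -/
theorem dirichletWindow_shift_apply (x : R) {k r i : ℕ} (h : r + i ≤ 2 ^ k) (j m : Fin i) :
    dirichletWindow x i (2 ^ k + r) j m = x * dirichletWindow (x + 1) i r j m := by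
  rw [dirichletWindow_apply, dirichletWindow_apply]
  have hm : r + (m : ℕ) < 2 ^ k := by have := m.isLt; omega
  have hj : (j : ℕ) < 2 ^ k := by have := j.isLt; omega
  rw [show 2 ^ k + r + (m : ℕ) = 2 ^ k + (r + (m : ℕ)) by ring, bits_two_pow_add hm]
  have hk : k ∉ bits (j : ℕ) := not_mem_bits_self hj
  by_cases hsub : bits (j : ℕ) ⊆ bits (r + (m : ℕ))
  · rw [if_pos ((Finset.subset_insert_iff_of_notMem hk).mpr hsub), if_pos hsub,
      Finset.card_insert_of_notMem (not_mem_bits_self hm)]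
    have : (bits (j : ℕ)).card ≤ (bits (r + (m : ℕ))).card := Finset.card_le_card hsub
    rw [show (bits (r + (m : ℕ))).card + 1 - (bits (j : ℕ)).card
        = ((bits (r + (m : ℕ))).card - (bits (j : ℕ)).card) + 1 by omega, rising_succ]
  · rw [if_neg (fun h' => hsub ((Finset.subset_insert_iff_of_notMem hk).mp h')), if_neg hsub, mul_zero]

/-- **(R1) of THEOREM W.** `det d(i, 2^k + r)(x) = x^i · det d(i, r)(x+1)` for `r + i ≤ 2^k`: the top binary digit
of the window start shifts the Dirichlet parameter by one and contributes the factor `x^i`. -/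
theorem det_dirichletWindow_shift (x : R) {k r i : ℕ} (h : r + i ≤ 2 ^ k) :
    (dirichletWindow x i (2 ^ k + r)).det = x ^ i * (dirichletWindow (x + 1) i r).det := by
  have e : dirichletWindow x i (2 ^ k + r) = x • dirichletWindow (x + 1) i r := by
    ext j m
    rw [Matrix.smul_apply, smul_eq_mul, dirichletWindow_shift_apply x h]
  rw [e, Matrix.det_smul, Fintype.card_fin]

/-! ## 5. (R2): a window crossing a power of two — block triangularity and complementation -/

section Flip

variable (x : R) {k a s n : ℕ} (h : a + s + n = 2 ^ k)

/-- Row splitting `Fin s ⊕ Fin n ≃ Fin (s+n)`: `inl j ↦ j`, `inr j' ↦ s + j'`. -/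
def flipRows (s n : ℕ) : Fin s ⊕ Fin n ≃ Fin (s + n) := finSumFinEquiv

/-- Column splitting `Fin s ⊕ Fin n ≃ Fin (s+n)`: `inl u ↦ n + u` (the columns with code `≥ 2^k`),
`inr t ↦ t` (the columns with code `< 2^k`). -/
def flipCols (s n : ℕ) : Fin s ⊕ Fin n ≃ Fin (s + n) :=
  (Equiv.sumComm (Fin s) (Fin n)).trans (finSumFinEquiv.trans (finCongr (Nat.add_comm n s)))

/-- Value of a top row index. -/
@[simp] theorem flipRows_inl (j : Fin s) : ((flipRows s n (Sum.inl j) : Fin (s + n)) : ℕ) = j := by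
  simp [flipRows]

/-- Value of a bottom row index. -/
@[simp] theorem flipRows_inr (j : Fin n) : ((flipRows s n (Sum.inr j) : Fin (s + n)) : ℕ) = s + j := by
  simp [flipRows]

/-- Value of a high column index. -/
@[simp] theorem flipCols_inl (u : Fin s) : ((flipCols s n (Sum.inl u) : Fin (s + n)) : ℕ) = n + u := by
  simp [flipCols, Nat.add_comm]

/-- Value of a low column index. -/
@[simp] theorem flipCols_inr (t : Fin n) : ((flipCols s n (Sum.inr t) : Fin (s + n)) : ℕ) = t := by
  simp [flipCols]

/-- The window `d(s+n, a+s)` with rows and columns split. -/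
def flipped (a s n : ℕ) : Matrix (Fin s ⊕ Fin n) (Fin s ⊕ Fin n) R :=
  (dirichletWindow x (s + n) (a + s)).submatrix (flipRows s n) (flipCols s n)

include h in
/-- The high columns vanish on the rows `s + j'`. -/
theorem flipped_inr_inl (j : Fin n) (u : Fin s) : flipped x a s n (Sum.inr j) (Sum.inl u) = 0 := by
  rw [flipped, Matrix.submatrix_apply, dirichletWindow_apply, flipRows_inr, flipCols_inl]
  have hu : (u : ℕ) < 2 ^ k := by have := u.isLt; omega
  have hj : s + (j : ℕ) < 2 ^ k := by have := j.isLt; omega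
  rw [show a + s + (n + (u : ℕ)) = 2 ^ k + (u : ℕ) by omega, if_neg]
  intro hsub
  rw [bits_two_pow_add hu, Finset.subset_insert_iff_of_notMem (not_mem_bits_self hj)] at hsub
  have := le_of_bits_subset hsub
  have := u.isLt
  omega

include h in
/-- The high block (rows `j < s`, high columns `u < s`): `[bits j ⊆ bits u] · x^{(|bits u| + 1 - |bits j|)}`. -/
theorem flipped_inl_inl (j u : Fin s) : flipped x a s n (Sum.inl j) (Sum.inl u) =
    if bits (j : ℕ) ⊆ bits (u : ℕ) then rising ((bits (u : ℕ)).card + 1 - (bits (j : ℕ)).card) x else 0 := by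
  rw [flipped, Matrix.submatrix_apply, dirichletWindow_apply, flipRows_inl, flipCols_inl]
  have hu : (u : ℕ) < 2 ^ k := by have := u.isLt; omega
  have hj : (j : ℕ) < 2 ^ k := by have := j.isLt; omega
  rw [show a + s + (n + (u : ℕ)) = 2 ^ k + (u : ℕ) by omega, bits_two_pow_add hu]
  by_cases hsub : bits (j : ℕ) ⊆ bits (u : ℕ)
  · rw [if_pos ((Finset.subset_insert_iff_of_notMem (not_mem_bits_self hj)).mpr hsub), if_pos hsub,
      Finset.card_insert_of_notMem (not_mem_bits_self hu)]
  · rw [if_neg (fun h' => hsub ((Finset.subset_insert_iff_of_notMem (not_mem_bits_self hj)).mp h')),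
      if_neg hsub]

include h in
/-- The high block is upper triangular with diagonal `x`: its determinant is `x^s`. -/
theorem det_flipped_toBlocks₁₁ : (flipped x a s n).toBlocks₁₁.det = x ^ s := by
  have tri : (flipped x a s n).toBlocks₁₁.BlockTriangular id := by
    intro j u hju
    rw [Matrix.toBlocks₁₁, Matrix.of_apply, flipped_inl_inl x h, if_neg]
    intro hsub
    have h1 := le_of_bits_subset hsub
    have h2 : (u : ℕ) < (j : ℕ) := hju
    omega
  rw [Matrix.det_of_upperTriangular tri]
  have : ∀ u : Fin s, (flipped x a s n).toBlocks₁₁ u u = x := by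
    intro u
    rw [Matrix.toBlocks₁₁, Matrix.of_apply, flipped_inl_inl x h, if_pos (subset_refl _),
      show (bits (u : ℕ)).card + 1 - (bits (u : ℕ)).card = 1 by omega, rising_one]
  simp_rw [this]
  rw [Finset.prod_const, Finset.card_univ, Fintype.card_fin]

include h in
/-- The low block (rows `s + j'`, low columns code `a + s + t`) is, by complementation in `[k]`, the
transpose of the window `d(n, a)` with rows and columns reversed. -/
theorem flipped_inr_inr (j t : Fin n) : flipped x a s n (Sum.inr j) (Sum.inr t) =
    dirichletWindow x n a (Fin.rev t) (Fin.rev j) := by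
  rw [flipped, Matrix.submatrix_apply, dirichletWindow_apply, dirichletWindow_apply, flipRows_inr,
    flipCols_inr, Fin.val_rev, Fin.val_rev]
  have ht : n - ((t : ℕ) + 1) < 2 ^ k := by omega
  have hj : a + (n - ((j : ℕ) + 1)) < 2 ^ k := by omega
  rw [← dirichlet_compl x ht hj,
    show 2 ^ k - 1 - (a + (n - ((j : ℕ) + 1))) = s + (j : ℕ) by have := j.isLt; omega,
    show 2 ^ k - 1 - (n - ((t : ℕ) + 1)) = a + s + (t : ℕ) by have := t.isLt; omega]

include h in
/-- Determinant of the low block. -/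
theorem det_flipped_toBlocks₂₂ :
    (flipped x a s n).toBlocks₂₂.det = (dirichletWindow x n a).det := by
  have e : (flipped x a s n).toBlocks₂₂ =
      ((dirichletWindow x n a).submatrix Fin.revPerm Fin.revPerm).transpose := by
    ext j t
    rw [Matrix.toBlocks₂₂, Matrix.of_apply, flipped_inr_inr x h, Matrix.transpose_apply,
      Matrix.submatrix_apply, Fin.revPerm_apply, Fin.revPerm_apply]
  rw [e, Matrix.det_transpose, Matrix.det_submatrix_equiv_self]

include h in
/-- **(R2) of THEOREM W.** If `a + s + n = 2^k` then `det d(s+n, a+s)(x) = ± x^s · det d(n, a)(x)`: a window that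
crosses the power of two `2^k` flips to the complementary window below it. -/
theorem det_dirichletWindow_flip : ∃ ε : ℤˣ,
    (dirichletWindow x (s + n) (a + s)).det = ((ε : ℤ) : R) * (x ^ s * (dirichletWindow x n a).det) := by
  classical
  set τ : Equiv.Perm (Fin s ⊕ Fin n) := (flipCols s n).trans (flipRows s n).symm with hτ
  refine ⟨Equiv.Perm.sign τ, ?_⟩
  have hB : flipped x a s n =
      ((dirichletWindow x (s + n) (a + s)).submatrix (flipRows s n) (flipRows s n)).submatrix id τ := by
    ext p q
    simp [flipped, hτ, Matrix.submatrix_apply]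
  have hdet : (flipped x a s n).det =
      ((Equiv.Perm.sign τ : ℤ) : R) * (dirichletWindow x (s + n) (a + s)).det := by
    rw [hB, Matrix.det_permute', Matrix.det_submatrix_equiv_self]
  have hblocks : (flipped x a s n).det = x ^ s * (dirichletWindow x n a).det := by
    rw [← Matrix.fromBlocks_toBlocks (flipped x a s n)]
    have z : (flipped x a s n).toBlocks₂₁ = 0 := by
      ext j u
      exact flipped_inr_inl x h j u
    rw [z, Matrix.det_fromBlocks_zero₂₁, det_flipped_toBlocks₁₁ x h, det_flipped_toBlocks₂₂ x h]
  have hε : ((Equiv.Perm.sign τ : ℤ) : R) * ((Equiv.Perm.sign τ : ℤ) : R) = 1 := by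
    rw [← Int.cast_mul, ← Units.val_mul, Int.units_mul_self, Units.val_one, Int.cast_one]
  calc (dirichletWindow x (s + n) (a + s)).det
      = (((Equiv.Perm.sign τ : ℤ) : R) * ((Equiv.Perm.sign τ : ℤ) : R)) *
          (dirichletWindow x (s + n) (a + s)).det := by rw [hε, one_mul]
    _ = ((Equiv.Perm.sign τ : ℤ) : R) * (flipped x a s n).det := by
          rw [hdet, mul_assoc]
    _ = ((Equiv.Perm.sign τ : ℤ) : R) * (x ^ s * (dirichletWindow x n a).det) := by rw [hblocks]

end Flip

end Window

end Summit.ValiantsHypothesis.ValiantsHypothesis.Theorems.BarrierLever.MoorePeel
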